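import Summits.QuantumFields.BalabanUV.Beta.GAN24.DiagramVolumeLimit

/-!
# `BalabanUV.Beta.GAN24.DiagramVolumeLimitAlgebra` — binder row G-an2-4 ∕ (CONV-C), route R7 «TWO CURRENCIES», PART 141: PART 130's DIAGRAM ALGEBRA PASSES TO `ℤ^d` —
# the two `ℤ^d`-side properties a unit-lattice tower needs for PART 140's generic END, SHIFT INVARIANCE (SI) and ENTRY LIMITS at integer sites (EL), are closed under the operations a
# lattice diagram is built from: sums, scalars, Hadamard products (parallel lines), transposes, diagonal parts (tadpoles) and — the internal vertex — MATRIX PRODUCTS (a torus sum: Tannery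
# over the window through PART 137's `tendsto_conv_complex`, given a volume-uniform bound on one factor and volume-uniform window decay on the other).  With PART 130–132 supplying
# (UD)+(SR) volume-free for the same operations, EVERY finite diagram of the effective form `Σ_k` on the unit lattice inherits the β-cell's `LimitRate` END on `ℤ^d` from PART 140 §1.
# Instance (§3): the two-propagator chain `Σ_k·Σ_k` (one internal vertex, summed over the torus) — UNCONDITIONALLY (`d ≥ 3`, `L ≥ 2`, `a > 0`, `μ ≠ ν`, even cubic volumes)
# (unit b2b-balaban-gan24-p3, gen 54; v1)

NOT IN PRINT; OUR PROOF ([folklore] bookkeeping BY NAME over PART 137 (`tendsto_conv_complex`), PART 140 (`conv_of_decay_of_tendsto`, `effForm_shift`, `tendsto_effForm_entry`, `tendsto_one_apply_castT`),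
PART 138 (`reindex_inv_sub_smul_one_apply`), PART 134 (`exp_distK_le_exp_window`), PART 132 (`decay_effForm`), PART 130 (`twoLevelDecayRate_mul`, `entryDecay_mul_tower`), PART 127
(`sum_exp_distK_le`, `distK_nonneg`, `distK_triangle`), Mathlib's `Fintype.sum_equiv`; [Balaban1987RG1] (1.21)–(1.22) p. 264 LOCATE the shapes; nothing printed is a hypothesis).
HONEST FRAMING (cell contract, verbatim): «discharging `BetaPertH` makes Bałaban's UV stability UNCONDITIONAL — a real constructive-QFT result; it is NOT the
continuum limit and NOT the Clay problem.»  HONEST DEPENDENCY (verbatim): «continuum YM on T⁴ ⇐ BetaPertH ∧ nine spine estimates (0/9 proved); BetaPertH ⇐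
(D1) ∧ (D4) ∧ CAP+tail; G-an2-4 gates asym, D1 and NE2/3/4.»

WHAT THIS FILE PROVES (0 sorry, 0 `def`; `e = (unitIdx L (cubic d s))⁻¹ : Site d s × Fin d → idx L (cubic d s) 0`, `ẑ` the reading of `z ∈ ℤ^d`; SI(X) ≡ `∀ x μ y ν v, X (e(x+v,μ)) (e(y+v,ν)) = X (e(x,μ)) (e(y,ν))`,
EL(X_t) ≡ `∀ μ ν z, ∃ s, X_t (e(ẑ,μ)) (e(0,ν)) → s` along `side t → ∞`):
* §1 one torus: `sum_idx_eq_sum_site` (re-indexing a sum over `idx` through `e`), `apply_eq_kernel_idx` (SI ⟹ `X (e(x,μ)) (e(y,ν)) = X (e(x−y,μ)) (e(0,ν))`), **`mul_apply_conv`** (SI(X) ⟹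
  `(X·Y) (e(x,μ)) (e(0,ν)) = Σ_λ Σ_w X (e(x−w,μ)) (e(0,λ)) · Y (e(w,λ)) (e(0,ν))`), SI of `X + Y`, `c•X`, `X ⊙ Y`, `Xᵀ`, `X·Y`, `diagonal (x ↦ X x x)`.
* §2 along `side t → ∞`: EL of sums ∕ scalars ∕ Hadamard products (pointwise), of transposes (SI: the entry at `(e(0,ν), e(ẑ,μ))` is the entry at `(e(−ẑ,ν), e(0,μ))`), of diagonal parts (the unit
  kernel at integer sites is eventually constant), and **`tendsto_mul_entry`** — EL OF PRODUCTS: SI(X_t), `‖X_t (e(w,μ)) (e(0,ν))‖ ≤ B`, `‖Y_t (e(w,μ)) (e(0,ν))‖ ≤ C·e^{−δ|windowMap w|₁}` (`δ > 0`),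
  EL(X_t), EL(Y_t) ⟹ EL(X_t·Y_t) (PART 137's Tannery).
* §3 **`conv_chain_effForm`** — the two-propagator chain `Σ_k·Σ_k` of the effective form on `ℤ^d`, UNCONDITIONALLY: `∃ κ > 0, B, B′ ≥ 0, Π` with `IsInfiniteVolumeLimit evenPeriod (Re (Σ_k·Σ_k)(e(·,μ′),e(0,ν′))) (Π k)`,
  `UniformDecay Π μ ν B (κ∕d)`, `StepRate Π μ ν B′ (κ∕d) (√(L⁻¹))`, `KernelInputs d Π`, `|secondMoment (Π k) μ ν − secondMoment Π_∞ μ ν| ≤ β′_d(B′∕(1−√(L⁻¹)), κ∕d)·(√(L⁻¹))^k` — (UD)+(SR) by PART 130's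
  product rule with PART 127's volume-free letter, EL by §2, END by PART 140 §1.
WHAT IT DOES NOT DO: legs on the pair lattice (`Γ₁(Σ_k ⊗ Σ_k)Γ₂ᴴ` — the Tannery there runs over `Site²`; follower), vertex kernels other than the lineage's (they enter §2 as displayed SI ∕ EL ∕
decay hypotheses — the socket for row an1's dictionary), `d ≤ 2`, odd volumes, `U ≠ 1`.  SUPPLIER work; no consumer of record; NEVER «G-an2-4 closed»; NOT (CONV-C), NOT D1, NOT `BetaPertH`,
NOT continuum, NOT Clay.  Records: `HOME/b2b-balaban-gan24-p3/gen54/README.md`.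
-/

noncomputable section

open scoped BigOperators ComplexConjugate Matrix Matrix.Norms.L2Operator
open Filter Topology

namespace Summit.QuantumFields.BalabanUV.Beta.GAN24.DiagramVolumeLimitAlgebra

open Literature.MathematicalPhysics.QuantumFieldTheory.Balaban1983to89
open Literature.MathematicalPhysics.QuantumFieldTheory.Balaban1983to89.B5Prop11Plancherel (Tor fine)
open Literature.MathematicalPhysics.QuantumFieldTheory.Balaban1983to89.B12Sec2to5 (l1 betaPrime510)
open Literature.MathematicalPhysics.QuantumFieldTheory.Balaban1983to89.Beta (Site windowMap IsInfiniteVolumeLimit)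
open Literature.MathematicalPhysics.QuantumFieldTheory.Balaban1983to89.Beta.FreeLegDictionary (cubic)
open Literature.MathematicalPhysics.QuantumFieldTheory.Balaban1983to89.Beta.BlockKernelVolumeSockets (evenPeriod tendsto_evenPeriod)
open Literature.MathematicalPhysics.QuantumFieldTheory.Balaban1983to89.Beta.VectorTails (castT castT_neg)
open Literature.MathematicalPhysics.QuantumFieldTheory.Balaban1983to89.Beta.LimitRate (StepRate limKernelOf KernelInputs)
open Summit.QuantumFields.BalabanUV.T4Continuum
open Summit.QuantumFields.BalabanUV.T4Continuum.BalabanAveragedTowerUnit (idx unitCovB)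
open Summit.QuantumFields.BalabanUV.T4Continuum.BalabanAveragedCoerciveTower (unitIdx)
open Summit.QuantumFields.BalabanUV.T4Continuum.CTKingTowerWeights (distK)
open Summit.QuantumFields.BalabanUV.T4Continuum.DecayRateInterpolation (EntryDecay TwoLevelDecayRate)
open Summit.QuantumFields.BalabanUV.Beta.GAN24.DiagramDecayAlgebra (twoLevelDecayRate_mul entryDecay_mul_tower)
open Summit.QuantumFields.BalabanUV.Beta.GAN24.UnitLatticeDecayAlgebra (sum_exp_distK_le distK_nonneg distK_triangle)
open Summit.QuantumFields.BalabanUV.Beta.GAN24.DiagramDecayTorus (decay_effForm)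
open Summit.QuantumFields.BalabanUV.Beta.GAN24.DiagramDecayWindow (exp_distK_le_exp_window)
open Summit.QuantumFields.BalabanUV.Beta.GAN24.VolumeLimitInverse (tendsto_conv_complex)
open Summit.QuantumFields.BalabanUV.Beta.GAN24.DiagramVolumeLimit (conv_of_decay_of_tendsto effForm_shift tendsto_effForm_entry tendsto_one_apply_castT)

variable {d : ℕ} (L : ℕ) [NeZero L]

/-! ## §1 One torus: sums over `idx` read through `e`; shift invariance of the algebra's operations -/

section OneTorus

variable (s : ℕ) [NeZero s]

/-- re-indexing a sum over the unit index set through `e = unitIdx⁻¹`. [folklore] -/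
theorem sum_idx_eq_sum_site (f : idx L (cubic d s) 0 → ℂ) :
    ∑ i, f i = ∑ l : Fin d, ∑ w : Site d s, f ((unitIdx L (cubic d s)).symm (w, l)) := by
  rw [← Fintype.sum_equiv (unitIdx L (cubic d s)).symm (fun p => f ((unitIdx L (cubic d s)).symm p)) f (fun p => rfl), Fintype.sum_prod_type, Finset.sum_comm]

omit [NeZero L] [NeZero s] in
/-- SI ⟹ the kernel form `X (e(x,μ)) (e(y,ν)) = X (e(x − y,μ)) (e(0,ν))`. [folklore] -/
theorem apply_eq_kernel_idx {X : Matrix (idx L (cubic d s) 0) (idx L (cubic d s) 0) ℂ}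
    (hX : ∀ (x : Site d s) μ (y : Site d s) ν (v : Site d s), X ((unitIdx L (cubic d s)).symm (x + v, μ)) ((unitIdx L (cubic d s)).symm (y + v, ν))
      = X ((unitIdx L (cubic d s)).symm (x, μ)) ((unitIdx L (cubic d s)).symm (y, ν)))
    (x : Site d s) (μ : Fin d) (y : Site d s) (ν : Fin d) :
    X ((unitIdx L (cubic d s)).symm (x, μ)) ((unitIdx L (cubic d s)).symm (y, ν)) = X ((unitIdx L (cubic d s)).symm (x - y, μ)) ((unitIdx L (cubic d s)).symm (0, ν)) := by
  have := hX (x - y) μ 0 ν y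
  rwa [sub_add_cancel, zero_add] at this

/-- **`mul_apply_conv` — A PRODUCT ENTRY IS A TORUS CONVOLUTION OF THE KERNELS** (SI of the left factor):
`(X·Y) (e(x,μ)) (e(0,ν)) = Σ_λ Σ_w X (e(x−w,μ)) (e(0,λ)) · Y (e(w,λ)) (e(0,ν))`. [folklore] -/
theorem mul_apply_conv {X Y : Matrix (idx L (cubic d s) 0) (idx L (cubic d s) 0) ℂ}
    (hX : ∀ (x : Site d s) μ (y : Site d s) ν (v : Site d s), X ((unitIdx L (cubic d s)).symm (x + v, μ)) ((unitIdx L (cubic d s)).symm (y + v, ν))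
      = X ((unitIdx L (cubic d s)).symm (x, μ)) ((unitIdx L (cubic d s)).symm (y, ν)))
    (x : Site d s) (μ ν : Fin d) :
    (X * Y) ((unitIdx L (cubic d s)).symm (x, μ)) ((unitIdx L (cubic d s)).symm (0, ν))
      = ∑ l : Fin d, ∑ w : Site d s, X ((unitIdx L (cubic d s)).symm (x - w, μ)) ((unitIdx L (cubic d s)).symm (0, l)) *
          Y ((unitIdx L (cubic d s)).symm (w, l)) ((unitIdx L (cubic d s)).symm (0, ν)) := by
  rw [Matrix.mul_apply, sum_idx_eq_sum_site]
  refine Finset.sum_congr rfl fun l _ => Finset.sum_congr rfl fun w _ => ?_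
  rw [apply_eq_kernel_idx L s hX x μ w l]

/-- SI of a product. [folklore] -/
theorem shift_mul {X Y : Matrix (idx L (cubic d s) 0) (idx L (cubic d s) 0) ℂ}
    (hX : ∀ (x : Site d s) μ (y : Site d s) ν (v : Site d s), X ((unitIdx L (cubic d s)).symm (x + v, μ)) ((unitIdx L (cubic d s)).symm (y + v, ν))
      = X ((unitIdx L (cubic d s)).symm (x, μ)) ((unitIdx L (cubic d s)).symm (y, ν)))
    (hY : ∀ (x : Site d s) μ (y : Site d s) ν (v : Site d s), Y ((unitIdx L (cubic d s)).symm (x + v, μ)) ((unitIdx L (cubic d s)).symm (y + v, ν))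
      = Y ((unitIdx L (cubic d s)).symm (x, μ)) ((unitIdx L (cubic d s)).symm (y, ν)))
    (x : Site d s) (μ : Fin d) (y : Site d s) (ν : Fin d) (v : Site d s) :
    (X * Y) ((unitIdx L (cubic d s)).symm (x + v, μ)) ((unitIdx L (cubic d s)).symm (y + v, ν)) = (X * Y) ((unitIdx L (cubic d s)).symm (x, μ)) ((unitIdx L (cubic d s)).symm (y, ν)) := by
  rw [Matrix.mul_apply, Matrix.mul_apply, sum_idx_eq_sum_site, sum_idx_eq_sum_site]
  refine Finset.sum_congr rfl fun l _ => ?_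
  rw [← Equiv.sum_comp (Equiv.addRight v)]
  refine Finset.sum_congr rfl fun w _ => ?_
  simp only [Equiv.coe_addRight, hX, hY]

omit [NeZero L] [NeZero s] in
/-- SI of a Hadamard product. [folklore] -/
theorem shift_hadamard {X Y : Matrix (idx L (cubic d s) 0) (idx L (cubic d s) 0) ℂ}
    (hX : ∀ (x : Site d s) μ (y : Site d s) ν (v : Site d s), X ((unitIdx L (cubic d s)).symm (x + v, μ)) ((unitIdx L (cubic d s)).symm (y + v, ν))
      = X ((unitIdx L (cubic d s)).symm (x, μ)) ((unitIdx L (cubic d s)).symm (y, ν)))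
    (hY : ∀ (x : Site d s) μ (y : Site d s) ν (v : Site d s), Y ((unitIdx L (cubic d s)).symm (x + v, μ)) ((unitIdx L (cubic d s)).symm (y + v, ν))
      = Y ((unitIdx L (cubic d s)).symm (x, μ)) ((unitIdx L (cubic d s)).symm (y, ν)))
    (x : Site d s) (μ : Fin d) (y : Site d s) (ν : Fin d) (v : Site d s) :
    (X ⊙ Y) ((unitIdx L (cubic d s)).symm (x + v, μ)) ((unitIdx L (cubic d s)).symm (y + v, ν)) = (X ⊙ Y) ((unitIdx L (cubic d s)).symm (x, μ)) ((unitIdx L (cubic d s)).symm (y, ν)) := by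
  simp only [Matrix.hadamard_apply, hX, hY]

omit [NeZero L] [NeZero s] in
/-- SI of a transpose. [folklore] -/
theorem shift_transpose {X : Matrix (idx L (cubic d s) 0) (idx L (cubic d s) 0) ℂ}
    (hX : ∀ (x : Site d s) μ (y : Site d s) ν (v : Site d s), X ((unitIdx L (cubic d s)).symm (x + v, μ)) ((unitIdx L (cubic d s)).symm (y + v, ν))
      = X ((unitIdx L (cubic d s)).symm (x, μ)) ((unitIdx L (cubic d s)).symm (y, ν)))
    (x : Site d s) (μ : Fin d) (y : Site d s) (ν : Fin d) (v : Site d s) :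
    Xᵀ ((unitIdx L (cubic d s)).symm (x + v, μ)) ((unitIdx L (cubic d s)).symm (y + v, ν)) = Xᵀ ((unitIdx L (cubic d s)).symm (x, μ)) ((unitIdx L (cubic d s)).symm (y, ν)) := by
  simp only [Matrix.transpose_apply, hX]

omit [NeZero L] [NeZero s] in
/-- SI of a sum. [folklore] -/
theorem shift_add {X Y : Matrix (idx L (cubic d s) 0) (idx L (cubic d s) 0) ℂ}
    (hX : ∀ (x : Site d s) μ (y : Site d s) ν (v : Site d s), X ((unitIdx L (cubic d s)).symm (x + v, μ)) ((unitIdx L (cubic d s)).symm (y + v, ν))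
      = X ((unitIdx L (cubic d s)).symm (x, μ)) ((unitIdx L (cubic d s)).symm (y, ν)))
    (hY : ∀ (x : Site d s) μ (y : Site d s) ν (v : Site d s), Y ((unitIdx L (cubic d s)).symm (x + v, μ)) ((unitIdx L (cubic d s)).symm (y + v, ν))
      = Y ((unitIdx L (cubic d s)).symm (x, μ)) ((unitIdx L (cubic d s)).symm (y, ν)))
    (c₁ c₂ : ℂ) (x : Site d s) (μ : Fin d) (y : Site d s) (ν : Fin d) (v : Site d s) :
    (c₁ • X + c₂ • Y) ((unitIdx L (cubic d s)).symm (x + v, μ)) ((unitIdx L (cubic d s)).symm (y + v, ν))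
      = (c₁ • X + c₂ • Y) ((unitIdx L (cubic d s)).symm (x, μ)) ((unitIdx L (cubic d s)).symm (y, ν)) := by
  simp only [Matrix.add_apply, Matrix.smul_apply, hX, hY]

omit [NeZero L] [NeZero s] in
/-- SI of the diagonal part (tadpole): `e(x+v,μ) = e(y+v,ν) ↔ e(x,μ) = e(y,ν)`. [folklore] -/
theorem shift_diagonal {X : Matrix (idx L (cubic d s) 0) (idx L (cubic d s) 0) ℂ}
    (hX : ∀ (x : Site d s) μ (y : Site d s) ν (v : Site d s), X ((unitIdx L (cubic d s)).symm (x + v, μ)) ((unitIdx L (cubic d s)).symm (y + v, ν))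
      = X ((unitIdx L (cubic d s)).symm (x, μ)) ((unitIdx L (cubic d s)).symm (y, ν)))
    (x : Site d s) (μ : Fin d) (y : Site d s) (ν : Fin d) (v : Site d s) :
    (Matrix.diagonal fun i => X i i) ((unitIdx L (cubic d s)).symm (x + v, μ)) ((unitIdx L (cubic d s)).symm (y + v, ν))
      = (Matrix.diagonal fun i => X i i) ((unitIdx L (cubic d s)).symm (x, μ)) ((unitIdx L (cubic d s)).symm (y, ν)) := by
  simp only [Matrix.diagonal_apply, Equiv.apply_eq_iff_eq, Prod.mk.injEq, add_left_inj, hX]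

end OneTorus

/-! ## §2 Along `side t → ∞`: entry limits of sums, Hadamard products, transposes, diagonal parts and PRODUCTS -/

section Limits

variable {side : ℕ → ℕ} [∀ t, NeZero (side t)]

omit [NeZero L] [∀ t, NeZero (side t)] in
/-- EL of a linear combination. [folklore] -/
theorem tendsto_add_entry {X Y : (t : ℕ) → Matrix (idx L (cubic d (side t)) 0) (idx L (cubic d (side t)) 0) ℂ} (c₁ c₂ : ℂ)
    (hX : ∀ μ ν (z : Fin d → ℤ), ∃ s' : ℂ, Tendsto (fun t => X t ((unitIdx L (cubic d (side t))).symm (castT (cubic d (side t)) z, μ)) ((unitIdx L (cubic d (side t))).symm (0, ν))) atTop (𝓝 s'))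
    (hY : ∀ μ ν (z : Fin d → ℤ), ∃ s' : ℂ, Tendsto (fun t => Y t ((unitIdx L (cubic d (side t))).symm (castT (cubic d (side t)) z, μ)) ((unitIdx L (cubic d (side t))).symm (0, ν))) atTop (𝓝 s'))
    (μ ν : Fin d) (z : Fin d → ℤ) :
    ∃ s' : ℂ, Tendsto (fun t => (c₁ • X t + c₂ • Y t) ((unitIdx L (cubic d (side t))).symm (castT (cubic d (side t)) z, μ)) ((unitIdx L (cubic d (side t))).symm (0, ν))) atTop (𝓝 s') := by
  obtain ⟨s₁, h₁⟩ := hX μ ν z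
  obtain ⟨s₂, h₂⟩ := hY μ ν z
  refine ⟨c₁ * s₁ + c₂ * s₂, ?_⟩
  simp only [Matrix.add_apply, Matrix.smul_apply, smul_eq_mul]
  exact (h₁.const_mul c₁).add (h₂.const_mul c₂)

omit [NeZero L] [∀ t, NeZero (side t)] in
/-- EL of a Hadamard product. [folklore] -/
theorem tendsto_hadamard_entry {X Y : (t : ℕ) → Matrix (idx L (cubic d (side t)) 0) (idx L (cubic d (side t)) 0) ℂ}
    (hX : ∀ μ ν (z : Fin d → ℤ), ∃ s' : ℂ, Tendsto (fun t => X t ((unitIdx L (cubic d (side t))).symm (castT (cubic d (side t)) z, μ)) ((unitIdx L (cubic d (side t))).symm (0, ν))) atTop (𝓝 s'))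
    (hY : ∀ μ ν (z : Fin d → ℤ), ∃ s' : ℂ, Tendsto (fun t => Y t ((unitIdx L (cubic d (side t))).symm (castT (cubic d (side t)) z, μ)) ((unitIdx L (cubic d (side t))).symm (0, ν))) atTop (𝓝 s'))
    (μ ν : Fin d) (z : Fin d → ℤ) :
    ∃ s' : ℂ, Tendsto (fun t => (X t ⊙ Y t) ((unitIdx L (cubic d (side t))).symm (castT (cubic d (side t)) z, μ)) ((unitIdx L (cubic d (side t))).symm (0, ν))) atTop (𝓝 s') := by
  obtain ⟨s₁, h₁⟩ := hX μ ν z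
  obtain ⟨s₂, h₂⟩ := hY μ ν z
  exact ⟨s₁ * s₂, by simp only [Matrix.hadamard_apply]; exact h₁.mul h₂⟩

omit [NeZero L] [∀ t, NeZero (side t)] in
/-- EL of a transpose (SI: the entry at `(e(0,ν), e(ẑ,μ))` is the entry at `(e(−ẑ,ν), e(0,μ))`). [folklore] -/
theorem tendsto_transpose_entry {X : (t : ℕ) → Matrix (idx L (cubic d (side t)) 0) (idx L (cubic d (side t)) 0) ℂ}
    (hsi : ∀ t (x : Site d (side t)) μ (y : Site d (side t)) ν (v : Site d (side t)), X t ((unitIdx L (cubic d (side t))).symm (x + v, μ)) ((unitIdx L (cubic d (side t))).symm (y + v, ν))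
      = X t ((unitIdx L (cubic d (side t))).symm (x, μ)) ((unitIdx L (cubic d (side t))).symm (y, ν)))
    (hX : ∀ μ ν (z : Fin d → ℤ), ∃ s' : ℂ, Tendsto (fun t => X t ((unitIdx L (cubic d (side t))).symm (castT (cubic d (side t)) z, μ)) ((unitIdx L (cubic d (side t))).symm (0, ν))) atTop (𝓝 s'))
    (μ ν : Fin d) (z : Fin d → ℤ) :
    ∃ s' : ℂ, Tendsto (fun t => (X t)ᵀ ((unitIdx L (cubic d (side t))).symm (castT (cubic d (side t)) z, μ)) ((unitIdx L (cubic d (side t))).symm (0, ν))) atTop (𝓝 s') := by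
  obtain ⟨s', h⟩ := hX ν μ (-z)
  refine ⟨s', h.congr fun t => ?_⟩
  rw [Matrix.transpose_apply, apply_eq_kernel_idx L (side t) (hsi t) 0 ν _ μ, zero_sub, castT_neg]

omit [NeZero L] in
/-- EL of the diagonal part (tadpole): the indicator `[e(ẑ,μ) = e(0,ν)]` is eventually constant. [folklore] -/
theorem tendsto_diagonal_entry (hside : Tendsto side atTop atTop) {X : (t : ℕ) → Matrix (idx L (cubic d (side t)) 0) (idx L (cubic d (side t)) 0) ℂ}
    (hX : ∀ μ ν (z : Fin d → ℤ), ∃ s' : ℂ, Tendsto (fun t => X t ((unitIdx L (cubic d (side t))).symm (castT (cubic d (side t)) z, μ)) ((unitIdx L (cubic d (side t))).symm (0, ν))) atTop (𝓝 s'))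
    (μ ν : Fin d) (z : Fin d → ℤ) :
    ∃ s' : ℂ, Tendsto (fun t => (Matrix.diagonal fun i => X t i i) ((unitIdx L (cubic d (side t))).symm (castT (cubic d (side t)) z, μ)) ((unitIdx L (cubic d (side t))).symm (0, ν)))
      atTop (𝓝 s') := by
  obtain ⟨s₀, h₀⟩ := hX ν ν 0
  have e0 : ∀ t, castT (cubic d (side t)) (0 : Fin d → ℤ) = 0 := fun t => by funext i; simp [castT]
  simp only [e0] at h₀
  refine ⟨(((if z = 0 ∧ μ = ν then (1 : ℝ) else 0 : ℝ) : ℂ)) * s₀, ?_⟩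
  have hind := tendsto_one_apply_castT (d := d) hside μ ν z
  refine (hind.mul h₀).congr' ?_
  filter_upwards with t
  simp only [Matrix.diagonal_apply, Matrix.one_apply, Equiv.apply_eq_iff_eq, Prod.mk.injEq]
  by_cases h : castT (cubic d (side t)) z = 0 ∧ μ = ν
  · rw [if_pos h, if_pos h, one_mul, h.1, h.2]
  · rw [if_neg h, if_neg h, zero_mul]

/-- **`tendsto_mul_entry` — ENTRY LIMITS OF PRODUCTS (the internal vertex: a torus sum)** [folklore]: along `side t → ∞`, SI of the left factor, a volume-uniform bound `‖X_t (e(w,μ)) (e(0,ν))‖ ≤ B`,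
volume-uniform window decay `‖Y_t (e(w,μ)) (e(0,ν))‖ ≤ C·e^{−δ|windowMap w|₁}` (`δ > 0`) and EL of both factors ⟹ EL of `X_t·Y_t` — PART 137's `tendsto_conv_complex` on the convolution form
`mul_apply_conv`. -/
theorem tendsto_mul_entry (hside : Tendsto side atTop atTop) {X Y : (t : ℕ) → Matrix (idx L (cubic d (side t)) 0) (idx L (cubic d (side t)) 0) ℂ}
    (hsi : ∀ t (x : Site d (side t)) μ (y : Site d (side t)) ν (v : Site d (side t)), X t ((unitIdx L (cubic d (side t))).symm (x + v, μ)) ((unitIdx L (cubic d (side t))).symm (y + v, ν))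
      = X t ((unitIdx L (cubic d (side t))).symm (x, μ)) ((unitIdx L (cubic d (side t))).symm (y, ν)))
    {B C δ : ℝ} (hB : ∀ t μ ν (w : Site d (side t)), ‖X t ((unitIdx L (cubic d (side t))).symm (w, μ)) ((unitIdx L (cubic d (side t))).symm (0, ν))‖ ≤ B)
    (hdec : ∀ t μ ν (w : Site d (side t)), ‖Y t ((unitIdx L (cubic d (side t))).symm (w, μ)) ((unitIdx L (cubic d (side t))).symm (0, ν))‖ ≤ C * Real.exp (-δ * l1 (windowMap d (side t) w)))
    (hδ : 0 < δ)
    (hX : ∀ μ ν (z : Fin d → ℤ), ∃ s' : ℂ, Tendsto (fun t => X t ((unitIdx L (cubic d (side t))).symm (castT (cubic d (side t)) z, μ)) ((unitIdx L (cubic d (side t))).symm (0, ν))) atTop (𝓝 s'))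
    (hY : ∀ μ ν (z : Fin d → ℤ), ∃ s' : ℂ, Tendsto (fun t => Y t ((unitIdx L (cubic d (side t))).symm (castT (cubic d (side t)) z, μ)) ((unitIdx L (cubic d (side t))).symm (0, ν))) atTop (𝓝 s'))
    (μ ν : Fin d) (z : Fin d → ℤ) :
    ∃ s' : ℂ, Tendsto (fun t => (X t * Y t) ((unitIdx L (cubic d (side t))).symm (castT (cubic d (side t)) z, μ)) ((unitIdx L (cubic d (side t))).symm (0, ν))) atTop (𝓝 s') := by
  choose P hP using hX
  choose Q hQ using hY
  have h := tendsto_conv_complex (d := d) hside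
    (P := fun t μ' ν' (w : Site d (side t)) => X t ((unitIdx L (cubic d (side t))).symm (w, μ')) ((unitIdx L (cubic d (side t))).symm (0, ν')))
    (Q := fun t μ' ν' (w : Site d (side t)) => Y t ((unitIdx L (cubic d (side t))).symm (w, μ')) ((unitIdx L (cubic d (side t))).symm (0, ν')))
    (Pinf := P) (Qinf := Q) (fun μ' ν' u => hP μ' ν' u) (fun μ' ν' u => hQ μ' ν' u) hB hdec hδ μ ν z
  refine ⟨_, h.congr fun t => ?_⟩
  exact (mul_apply_conv L (side t) (hsi t) _ μ ν).symm

end Limits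

/-! ## §3 Instance: the two-propagator chain `Σ_k·Σ_k` of the effective form on `ℤ^d`, unconditionally -/

variable (a : ℝ) (ha : 0 < a)

/-- **`conv_chain_effForm` — THE TWO-PROPAGATOR CHAIN `Σ_k·Σ_k` ON `ℤ^d`, UNCONDITIONALLY** [our proof] (`d ≥ 3`, `L ≥ 2`, `a > 0`, `μ ≠ ν`, along the even cubic volumes `side t = 2(t+1)`):
there are `κ > 0`, `B, B′ ≥ 0` (from `(d, L, a)`) and limit kernels `Π_k` with `IsInfiniteVolumeLimit evenPeriod (Re (Σ_k·Σ_k)(e(·,μ′), e(0,ν′))) (Π k)` for every `k`,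
`UniformDecay Π μ ν B (κ∕d)`, `StepRate Π μ ν B′ (κ∕d) (√(L⁻¹))`, `KernelInputs d Π` inhabited, and `∀ k, |secondMoment (Π k) μ ν − secondMoment (limKernelOf Π) μ ν| ≤ β′_d(B′∕(1−√(L⁻¹)), κ∕d)·(√(L⁻¹))^k`
— (UD)+(SR) by PART 130's product rule (`entryDecay_mul_tower`, `twoLevelDecayRate_mul`) with PART 127's volume-free letter `sum_exp_distK_le`; EL by `tendsto_mul_entry` (SI `effForm_shift`,
bound and window decay from PART 132's (UD) through PART 134's `exp_distK_le_exp_window`, EL of `Σ_k` by PART 140's `tendsto_effForm_entry`); END by PART 140's `conv_of_decay_of_tendsto`.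
[cite: Balaban1987RG1, (1.21)–(1.22) p.264 (shapes)] -/
theorem conv_chain_effForm (hL : 2 ≤ L) (hd : 3 ≤ d) {μ ν : Fin d} (hne : μ ≠ ν) :
    ∃ κ B B' : ℝ, 0 < κ ∧ 0 ≤ B ∧ 0 ≤ B' ∧ ∃ Pinf : ℕ → B12Beta.Kernel d,
      (∀ k, IsInfiniteVolumeLimit evenPeriod
        (fun t μ' ν' (z : Site d (evenPeriod t)) =>
          ((((unitCovB L (cubic d (evenPeriod t)) a ha k)⁻¹ - (a : ℂ) • (1 : Matrix (idx L (cubic d (evenPeriod t)) 0) (idx L (cubic d (evenPeriod t)) 0) ℂ)) *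
            ((unitCovB L (cubic d (evenPeriod t)) a ha k)⁻¹ - (a : ℂ) • (1 : Matrix (idx L (cubic d (evenPeriod t)) 0) (idx L (cubic d (evenPeriod t)) 0) ℂ)))
            ((unitIdx L (cubic d (evenPeriod t))).symm (z, μ')) ((unitIdx L (cubic d (evenPeriod t))).symm (0, ν'))).re) (Pinf k)) ∧
      Beta.LimitRate.UniformDecay Pinf μ ν B (κ / d) ∧ StepRate Pinf μ ν B' (κ / d) (Real.sqrt ((L : ℝ)⁻¹)) ∧
      (∃ K : KernelInputs d Pinf, K.θ = Real.sqrt ((L : ℝ)⁻¹) ∧ K.c₀ = betaPrime510 d (B' / (1 - Real.sqrt ((L : ℝ)⁻¹))) (κ / d) ∧ K.Pinf = limKernelOf Pinf ∧ K.μ = μ ∧ K.ν = ν) ∧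
      (∀ k, |B12Beta.secondMoment (Pinf k) μ ν - B12Beta.secondMoment (limKernelOf Pinf) μ ν|
          ≤ betaPrime510 d (B' / (1 - Real.sqrt ((L : ℝ)⁻¹))) (κ / d) * Real.sqrt ((L : ℝ)⁻¹) ^ k) := by
  have hd1 : 1 ≤ d := le_trans (by norm_num) hd
  have hd2 : 2 ≤ d := le_trans (by norm_num) hd
  obtain ⟨κ', Bs, Bs', hκ', hBs, hBs', h⟩ := decay_effForm L a ha hL hd2
  obtain ⟨S, hS0, hS⟩ := sum_exp_distK_le (d := d) hd2 (half_pos hκ')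
  have hL1 : (1 : ℝ) < L := by exact_mod_cast (lt_of_lt_of_le one_lt_two hL : 1 < L)
  have hθ0 : 0 ≤ Real.sqrt ((L : ℝ)⁻¹) := Real.sqrt_nonneg _
  have hθ1 : Real.sqrt ((L : ℝ)⁻¹) < 1 := by
    rw [show (1 : ℝ) = Real.sqrt 1 from Real.sqrt_one.symm]
    exact Real.sqrt_lt_sqrt (inv_nonneg.mpr (Nat.cast_nonneg _)) (inv_lt_one_of_one_lt₀ hL1)
  refine ⟨κ' / 2, Bs * Bs * (d * S), (Bs' * Bs + Bs * Bs') * (d * S), half_pos hκ', by positivity, by positivity, ?_⟩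
  have hud : ∀ t k, EntryDecay (distK L (cubic d (evenPeriod t)))
      (((unitCovB L (cubic d (evenPeriod t)) a ha k)⁻¹ - (a : ℂ) • (1 : Matrix (idx L (cubic d (evenPeriod t)) 0) (idx L (cubic d (evenPeriod t)) 0) ℂ)) *
        ((unitCovB L (cubic d (evenPeriod t)) a ha k)⁻¹ - (a : ℂ) • (1 : Matrix (idx L (cubic d (evenPeriod t)) 0) (idx L (cubic d (evenPeriod t)) 0) ℂ))) (Bs * Bs * (d * S)) (κ' / 2) :=
    fun t k => entryDecay_mul_tower (distK_nonneg L (cubic d (evenPeriod t))) (distK_triangle L (cubic d (evenPeriod t))) hκ'.le (hS L (cubic d (evenPeriod t)))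
      (h (cubic d (evenPeriod t))).1 (h (cubic d (evenPeriod t))).1 k
  have hsr : ∀ t, TwoLevelDecayRate (distK L (cubic d (evenPeriod t)))
      (fun k => ((unitCovB L (cubic d (evenPeriod t)) a ha k)⁻¹ - (a : ℂ) • (1 : Matrix (idx L (cubic d (evenPeriod t)) 0) (idx L (cubic d (evenPeriod t)) 0) ℂ)) *
        ((unitCovB L (cubic d (evenPeriod t)) a ha k)⁻¹ - (a : ℂ) • (1 : Matrix (idx L (cubic d (evenPeriod t)) 0) (idx L (cubic d (evenPeriod t)) 0) ℂ)))
      ((Bs' * Bs + Bs * Bs') * (d * S)) (κ' / 2) (Real.sqrt ((L : ℝ)⁻¹)) :=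
    fun t => twoLevelDecayRate_mul (distK_nonneg L (cubic d (evenPeriod t))) (distK_triangle L (cubic d (evenPeriod t))) hκ'.le (hS L (cubic d (evenPeriod t)))
      (h (cubic d (evenPeriod t))).1 (h (cubic d (evenPeriod t))).1 (h (cubic d (evenPeriod t))).2 (h (cubic d (evenPeriod t))).2
  refine conv_of_decay_of_tendsto L hd1 tendsto_evenPeriod (half_pos hκ') hθ0 hθ1 hud hsr ?_ hne
  intro k μ' ν' z
  have hd0 : (0 : ℝ) < d := by exact_mod_cast lt_of_lt_of_le zero_lt_one hd1
  -- EL of each factor (PART 140) and the bound ∕ window decay of the entries read from the origin (PART 132's (UD) through PART 134's dictionary)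
  have hel : ∀ μ ν (z : Fin d → ℤ), ∃ s' : ℂ, Tendsto (fun t => ((unitCovB L (cubic d (evenPeriod t)) a ha k)⁻¹
      - (a : ℂ) • (1 : Matrix (idx L (cubic d (evenPeriod t)) 0) (idx L (cubic d (evenPeriod t)) 0) ℂ))
      ((unitIdx L (cubic d (evenPeriod t))).symm (castT (cubic d (evenPeriod t)) z, μ)) ((unitIdx L (cubic d (evenPeriod t))).symm (0, ν))) atTop (𝓝 s') := by
    intro μ ν z
    obtain ⟨s', hs'⟩ := tendsto_effForm_entry L a ha hd k μ ν z 0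
    have e0 : ∀ t, castT (cubic d (evenPeriod t)) (0 : Fin d → ℤ) = 0 := fun t => by funext i; simp [castT]
    simp only [e0] at hs'
    exact ⟨s', hs'⟩
  have hbd : ∀ t μ ν (w : Site d (evenPeriod t)), ‖((unitCovB L (cubic d (evenPeriod t)) a ha k)⁻¹
      - (a : ℂ) • (1 : Matrix (idx L (cubic d (evenPeriod t)) 0) (idx L (cubic d (evenPeriod t)) 0) ℂ))
      ((unitIdx L (cubic d (evenPeriod t))).symm (w, μ)) ((unitIdx L (cubic d (evenPeriod t))).symm (0, ν))‖ ≤ Bs * Real.exp (-(κ' / d) * l1 (windowMap d (evenPeriod t) w)) :=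
    fun t μ ν w => ((h (cubic d (evenPeriod t))).1 k _ _).trans (mul_le_mul_of_nonneg_left (exp_distK_le_exp_window L (evenPeriod t) hκ'.le w μ ν) hBs)
  have hB : ∀ t μ ν (w : Site d (evenPeriod t)), ‖((unitCovB L (cubic d (evenPeriod t)) a ha k)⁻¹
      - (a : ℂ) • (1 : Matrix (idx L (cubic d (evenPeriod t)) 0) (idx L (cubic d (evenPeriod t)) 0) ℂ))
      ((unitIdx L (cubic d (evenPeriod t))).symm (w, μ)) ((unitIdx L (cubic d (evenPeriod t))).symm (0, ν))‖ ≤ Bs := by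
    intro t μ ν w
    refine (hbd t μ ν w).trans ?_
    have : Real.exp (-(κ' / d) * l1 (windowMap d (evenPeriod t) w)) ≤ 1 := by
      rw [Real.exp_le_one_iff, neg_mul, neg_nonpos]
      exact mul_nonneg (div_pos hκ' hd0).le (Finset.sum_nonneg fun i _ => abs_nonneg _)
    simpa using mul_le_mul_of_nonneg_left this hBs
  exact tendsto_mul_entry L tendsto_evenPeriod (fun t x μ y ν v => effForm_shift L a ha (cubic d (evenPeriod t)) k x μ y ν v) hB hbd (div_pos hκ' hd0) hel hel μ' ν' z

/-! ## §4 (v1.1, append-only) Instance: the tadpole `diag(Σ_k(x,x))` of PART 132 on `ℤ^d`, unconditionally -/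

/-- **`conv_tadpole_effForm` — THE TADPOLE `diagonal (x ↦ Σ_k(x,x))` ON `ℤ^d`, UNCONDITIONALLY** [our proof] (`d ≥ 3`, `L ≥ 2`, `a > 0`, `μ ≠ ν`, along the even cubic volumes `side t = 2(t+1)`):
PART 132's `twoLevelDecayRate_tadpole_effForm` ((UD)+(SR) volume-free) + EL by `tendsto_diagonal_entry` (EL of `Σ_k` from PART 140) ⟹ PART 140's generic END: `∃ κ′ > 0, Bs, Bs′ ≥ 0, Π` with the
volume limits, `UniformDecay Π μ ν Bs (κ′∕d)`, `StepRate Π μ ν Bs′ (κ′∕d) (√(L⁻¹))`, `KernelInputs d Π`, `|secondMoment (Π k) μ ν − secondMoment Π_∞ μ ν| ≤ β′_d(Bs′∕(1−√(L⁻¹)), κ′∕d)·(√(L⁻¹))^k`.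
(For a tadpole the kernels are supported at the origin, so the second moments vanish — the END is recorded for completeness of PART 132's list.) [cite: Balaban1987RG1, (1.21)–(1.22) p.264 (shapes)] -/
theorem conv_tadpole_effForm (a : ℝ) (ha : 0 < a) (hL : 2 ≤ L) (hd : 3 ≤ d) {μ ν : Fin d} (hne : μ ≠ ν) :
    ∃ κ' Bs Bs' : ℝ, 0 < κ' ∧ 0 ≤ Bs ∧ 0 ≤ Bs' ∧ ∃ Pinf : ℕ → B12Beta.Kernel d,
      (∀ k, IsInfiniteVolumeLimit evenPeriod
        (fun t μ' ν' (z : Site d (evenPeriod t)) =>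
          ((Matrix.diagonal fun x => ((unitCovB L (cubic d (evenPeriod t)) a ha k)⁻¹
              - (a : ℂ) • (1 : Matrix (idx L (cubic d (evenPeriod t)) 0) (idx L (cubic d (evenPeriod t)) 0) ℂ)) x x)
            ((unitIdx L (cubic d (evenPeriod t))).symm (z, μ')) ((unitIdx L (cubic d (evenPeriod t))).symm (0, ν'))).re) (Pinf k)) ∧
      Beta.LimitRate.UniformDecay Pinf μ ν Bs (κ' / d) ∧ StepRate Pinf μ ν Bs' (κ' / d) (Real.sqrt ((L : ℝ)⁻¹)) ∧
      (∃ K : KernelInputs d Pinf, K.θ = Real.sqrt ((L : ℝ)⁻¹) ∧ K.c₀ = betaPrime510 d (Bs' / (1 - Real.sqrt ((L : ℝ)⁻¹))) (κ' / d) ∧ K.Pinf = limKernelOf Pinf ∧ K.μ = μ ∧ K.ν = ν) ∧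
      (∀ k, |B12Beta.secondMoment (Pinf k) μ ν - B12Beta.secondMoment (limKernelOf Pinf) μ ν|
          ≤ betaPrime510 d (Bs' / (1 - Real.sqrt ((L : ℝ)⁻¹))) (κ' / d) * Real.sqrt ((L : ℝ)⁻¹) ^ k) := by
  have hd1 : 1 ≤ d := le_trans (by norm_num) hd
  obtain ⟨κ', Bs, Bs', hκ', hBs, hBs', h⟩ := DiagramDecayTorus.twoLevelDecayRate_tadpole_effForm L a ha hL (le_trans (by norm_num) hd)
  have hL1 : (1 : ℝ) < L := by exact_mod_cast (lt_of_lt_of_le one_lt_two hL : 1 < L)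
  have hθ0 : 0 ≤ Real.sqrt ((L : ℝ)⁻¹) := Real.sqrt_nonneg _
  have hθ1 : Real.sqrt ((L : ℝ)⁻¹) < 1 := by
    rw [show (1 : ℝ) = Real.sqrt 1 from Real.sqrt_one.symm]
    exact Real.sqrt_lt_sqrt (inv_nonneg.mpr (Nat.cast_nonneg _)) (inv_lt_one_of_one_lt₀ hL1)
  refine ⟨κ', Bs, Bs', hκ', hBs, hBs', ?_⟩
  refine conv_of_decay_of_tendsto L hd1 tendsto_evenPeriod hκ' hθ0 hθ1 (fun t => (h (cubic d (evenPeriod t))).1) (fun t => (h (cubic d (evenPeriod t))).2) ?_ hne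
  intro k μ' ν' z
  refine tendsto_diagonal_entry L tendsto_evenPeriod ?_ μ' ν' z
  intro μ ν z
  obtain ⟨s', hs'⟩ := tendsto_effForm_entry L a ha hd k μ ν z 0
  have e0 : ∀ t, castT (cubic d (evenPeriod t)) (0 : Fin d → ℤ) = 0 := fun t => by funext i; simp [castT]
  simp only [e0] at hs'
  exact ⟨s', hs'⟩

end Summit.QuantumFields.BalabanUV.Beta.GAN24.DiagramVolumeLimitAlgebra

end
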